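import Summits.PneNP.PneNP.Theorems.SzkEntropyPeaWorstToAvgDualModeCompileDefs
import Literature.Computability.Complexity.RandomizingPolynomialsGenericBlock
import HarnessLib

/-!
# Route SzkEntropy, crux `PeaWorstToAvg` (stmt-PneNP-10777), line `dual-mode-compile`: stub `stub_blockPerf`

The valuation-level PERFECTNESS of ONE Ishai–Kushilevitz block.  For a SYMBOLIC unit-lower-Hessenberg matrix
`Lsym` (entry `(j, l)` a sparse polynomial over `F₂`: the constant `1 = [[]]` on the subdiagonal `j = l + 1`, the
zero polynomial `[]` below it, polynomials in variables `< n₀` on and above the diagonal) the block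
`blockOf n₀ d Lsym` (the entries `i ≤ k` of `R₁ · Lsym · R₂`, `R₁` the symbolic upper unitriangular randomizer
`RandPoly.symR1`, `R₂ = 1 + last column` the randomizer `RandPoly.symR2`, fresh variables `[n₀, n₀ + pos d d)`) is
a PERFECT EXTENSION (`RandPoly.PerfExt`: injective on the fresh variables, the outputs decode the target, the
output set over a fixed prefix depends only on the target) of `v ↦ det L(v)`, `L(v)` the matrix `Lsym` evaluated
at the valuation `v` — FROM the general canonical form `A · L · B = C_{det L}` (`A` upper unitriangular, `B`
last-column), which is the hypothesis `hcanon` (the sibling stub `stub_canon` of the line; not proved here).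

Proof.  `entryOf` / `blockOf` (the line's Defs) are literally the tree's generic symbolic block
`RandPoly.gEntry` / `RandPoly.gBlock` (`RandomizingPolynomialsGenericBlock.lean`), whose theorem
`RandPoly.perfExt_gBlock` [Applebaum–Ishai–Kushilevitz 2006, Lemma 4.15] gives the three properties for the
target `v ↦ δ(L(v))`, the corner value of the constructive canonical form `M = U(M) · C_{δ(M)} · V(M)` of a
matrix of branching-program shape (`RandomizingPolynomialsShape.lean`), for every family `L(v)` of BP-shape
matrices depending on `v` only below `n₀` — both hypotheses are read off the three symbolic hypotheses on
`Lsym`.  The hypothesis `hcanon` supplies a second canonical form `A · L(v) · B = C_{det L(v)} = 1 · C · 1`;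
UNIQUENESS of the canonical form (`RandPoly.eq_of_proj_eq_aux`, i.e. `RandPoly.eq_of_proj_canon_eq`
[Ishai–Kushilevitz 2002, §3]) identifies `δ(L(v)) = det L(v)`, and a perfect extension depends on its target only
through the target's fibres.

References: Y. Ishai, E. Kushilevitz, ICALP 2002, §3; B. Applebaum, Y. Ishai, E. Kushilevitz, SIAM J. Comput.
36 (2006), §4.2 (Fact 4.6, Lemma 4.9), §4.3 (Facts 4.13–4.14, Lemma 4.15).
-/

namespace Summit.PneNP.PneNP.Cruxes.PeaWorstToAvg.DualModeCompile

open Literature.Computability.Complexity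

set_option linter.dupNamespace false -- `Summit.PneNP.PneNP.…`: summit = sub-problem name (D-0017 single-conjunct layout)

/-- The identity matrix is upper unitriangular. [folklore] -/
theorem blockPerf_isUnitri_one (d : ℕ) : RandPoly.IsUnitri (1 : RandPoly.Mat d) :=
  ⟨fun i => Matrix.one_apply_eq i, fun _ _ hji => Matrix.one_apply_ne hji.ne'⟩

/-- The identity matrix is a last-column matrix (`1 +` nothing). [folklore] -/
theorem blockPerf_isLastCol_one (d : ℕ) : RandPoly.IsLastCol (1 : RandPoly.Mat d) :=
  ⟨fun i => Matrix.one_apply_eq i, fun _ _ hij _ => Matrix.one_apply_ne hij⟩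

/-- **Corner value = determinant.**  If a matrix `M` of branching-program shape admits a canonical form
`A · M · B = C_{det M}` with `A` upper unitriangular and `B` last-column, then the corner value `δ(M)` of its
constructive canonical form `M = U(M) · C_{δ(M)} · V(M)` equals `det M` — uniqueness of the Ishai–Kushilevitz
canonical form, applied to `(A · U(M)) · C_{δ(M)} · (V(M) · B) = 1 · C_{det M} · 1`. [cite: IshaiKushilevitz2002, §3] -/
theorem blockPerf_corner_eq_det {d : ℕ} {M A B : RandPoly.Mat d} (hM : RandPoly.IsBPShape M)
    (hA : RandPoly.IsUnitri A) (hB : RandPoly.IsLastCol B) (h : A * M * B = RandPoly.canon M.det) :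
    RandPoly.corner M = M.det :=
  (RandPoly.eq_of_proj_eq_aux (RandPoly.eq_shiftU_mul_canon_mul_colV hM)
    (show RandPoly.canon (d := d) M.det = 1 * RandPoly.canon M.det * 1 by
      rw [Matrix.one_mul, Matrix.mul_one])
    (RandPoly.shiftU_isUnitri hM) (RandPoly.colV_isLastCol M) (blockPerf_isUnitri_one d)
    (blockPerf_isLastCol_one d) hA (blockPerf_isUnitri_one d) hB (blockPerf_isLastCol_one d)
    (fun i k _ => by rw [h, Matrix.one_mul, Matrix.mul_one])).2.2

/-- **Perfectness of one Ishai–Kushilevitz block of a general symbolic Hessenberg matrix** (registered stub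
`stub_blockPerf` of the line `dual-mode-compile`).  Assuming the general canonical form `hcanon`
(`A · L · B = C_{det L}` for every unit-lower-Hessenberg `L`; the sibling stub `stub_canon`): for every symbolic
matrix `Lsym` with the constant polynomial `1` on the subdiagonal, `0` below it and polynomials in variables
`< n₀` on and above the diagonal, the block `blockOf n₀ d Lsym` is a perfect extension, with fresh variables
`[n₀, n₀ + pos d d)`, of `v ↦ det L(v)` — injective on the fresh variables, decoding `det L(v)`, and with output
set over a fixed prefix depending only on `det L(v)`.  The tree's `RandPoly.perfExt_gBlock` (target: the corner
value `δ(L(v))`) with the target exchanged along `δ(L(v)) = det L(v)` (`blockPerf_corner_eq_det`, from `hcanon`).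
[cite: IshaiKushilevitz2002, §3] [cite: ApplebaumIshaiKushilevitz2006, §4.2 Fact 4.6 and Lemma 4.9; §4.3 Lemma 4.15] -/
theorem stub_blockPerf
    (hcanon : ∀ (d : ℕ) (L : RandPoly.Mat d),
      (∀ i j : Fin (d + 1), i.val = j.val + 1 → L i j = 1) →
      (∀ i j : Fin (d + 1), j.val + 1 < i.val → L i j = 0) →
      ∃ A B : RandPoly.Mat d, RandPoly.IsUnitri A ∧ RandPoly.IsLastCol B ∧ A * L * B = RandPoly.canon L.det) :
    ∀ (n₀ d : ℕ) (Lsym : ℕ → ℕ → List (List ℕ)),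
      (∀ j l : ℕ, j = l + 1 → Lsym j l = [[]]) →
      (∀ j l : ℕ, l + 1 < j → Lsym j l = []) →
      (∀ j l : ℕ, j ≤ l → ∀ μ ∈ Lsym j l, ∀ x ∈ μ, x < n₀) →
      RandPoly.PerfExt n₀ (n₀ + RandPoly.pos d d) (blockOf n₀ d Lsym)
        (fun v => (Matrix.of fun (j l : Fin (d + 1)) => RandPoly.evalP v (Lsym j.val l.val)).det) := by
  intro n₀ d Lsym hsub hzero hvars
  -- the evaluated matrix `L(v)` has branching-program shape …
  have hshape : ∀ v : ℕ → ZMod 2,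
      RandPoly.IsBPShape (Matrix.of fun (j l : Fin (d + 1)) => RandPoly.evalP v (Lsym j.val l.val)) :=
    fun v => ⟨fun j l h => by simp [hsub j.val l.val h], fun j l h => by simp [hzero j.val l.val h]⟩
  -- … depends on the valuation only below `n₀` …
  have hagree : ∀ v w : ℕ → ZMod 2, RandPoly.AgreeBelow n₀ v w →
      (Matrix.of fun (j l : Fin (d + 1)) => RandPoly.evalP v (Lsym j.val l.val)) =
        Matrix.of fun (j l : Fin (d + 1)) => RandPoly.evalP w (Lsym j.val l.val) := by
    intro v w hvw
    ext j l
    simp only [Matrix.of_apply]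
    by_cases hjl : j.val ≤ l.val
    · exact RandPoly.evalP_congr fun μ hμ x hx => hvw x (hvars j.val l.val hjl μ hμ x hx)
    · by_cases h1 : j.val = l.val + 1
      · simp [hsub j.val l.val h1]
      · simp [hzero j.val l.val (by omega)]
  -- … and its corner value is its determinant (uniqueness of the canonical form `hcanon`)
  have hcd : ∀ v : ℕ → ZMod 2,
      RandPoly.corner (Matrix.of fun (j l : Fin (d + 1)) => RandPoly.evalP v (Lsym j.val l.val)) =
        (Matrix.of fun (j l : Fin (d + 1)) => RandPoly.evalP v (Lsym j.val l.val)).det := fun v => by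
    obtain ⟨A, B, hA, hB, hc⟩ := hcanon d _ (hshape v).1 (hshape v).2
    exact blockPerf_corner_eq_det (hshape v) hA hB hc
  -- the generic block is a perfect extension of the corner value; exchange the target
  have h := RandPoly.perfExt_gBlock n₀ (symX := Lsym)
    (X := fun v => Matrix.of fun (j l : Fin (d + 1)) => RandPoly.evalP v (Lsym j.val l.val))
    (fun _ _ _ => rfl) hshape hagree
  have hb : blockOf n₀ d Lsym = RandPoly.gBlock n₀ d Lsym := rfl
  rw [hb]
  exact ⟨h.inj, fun v w he => (hcd v).symm.trans ((h.dec v w he).trans (hcd w)),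
    fun v w hf => h.range v w ((hcd v).trans (hf.trans (hcd w).symm))⟩

end Summit.PneNP.PneNP.Cruxes.PeaWorstToAvg.DualModeCompile
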